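import Summits.QuantumFields.BalabanUV.T4Continuum.Support.NE7StrippedConstraintC2
import Summits.QuantumFields.BalabanUV.T4Continuum.Support.NE7QbarIterL1DbarFree
import Summits.QuantumFields.BalabanUV.T4Continuum.Support.NE7SecondDerivativeFromQuadraticBound
import Summits.QuantumFields.BalabanUV.T4Continuum.Support.NE7MultiplierTermStepSharp
import Summits.QuantumFields.BalabanUV.T4Continuum.Support.NE7TorusChartDecoding
import HarnessLib

/-!
# NE7StrippedMultiplierLetterL1 — THE SECOND DIFFERENTIAL OF THE STRIPPED CONSTRAINT HAS SCALED TORUS-ℓ¹ MASS: `‖D²Ψ(0)[X,X]‖_{ℓ¹(periodBox N)} ≤ 128·C₁L²·d(4L+1)^d·((L∕L^d)·L)^j·dirSq X̃`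
# (lineage `b2b-balaban-t4-ne7-p1`, gen 119, file H14 = ROAD-G119 §5 S4′ (i)–(iv) assembled: the local stripped multiplier letter in its ℓ¹ form, general `d`)

Cell `pub-balaban`, rung (B)+1 sub-cell t4, CRUX PROVER NE7 #1 (OWNER of row NE7), generation 119.
WHY (memo ROAD-G119 §2, §5).  ✓ H10 `NE7MultiplierStrippedIdentity`: on top-frame-free directions the multiplier term of the bordered Hessian of the constrained minimal action is
`Dm(0)[D²Ψ(0)[X,X]]`, `Ψ = strippedConstraint` (the double-bar tower in the torus chart); ✓ H11 `NE7EffectiveFormLowerBoundSocket`: (G′) follows from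
`|Dm(0)[D²Ψ(0)[X,X]]| ≤ C_Λ·η²·dirSq X̃`; ✓ `NE7MultiplierDensity.multiplier_density_allData_uniform`: `|Dm(0)[γ]| ≤ 2·curl1C·ε·‖γ‖_{ℓ¹(periodBox N)}`.  THIS FILE bounds
`‖D²Ψ(0)[X,X]‖_{ℓ¹(periodBox N)}`: near `0`, `Ψ(tX) = skewPR (Ad_{Ū}⁻¹ logCovIter_{j+1}(Ad_{U♯}(tX̃)))` (✓ H8 `strippedConstraint_eq_skewPR_levelField`) and
`t·DΨ(0)X = skewPR (QbarIter_{j+1}(tX̃))` (✓ H7 `hasFDerivAt_strippedConstraint`, ✓ `QbarIter_smul`), so `Ψ(tX) − t·DΨ(0)X` is the skew projection of gen 96's END-FRAMED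
REMAINDER, whose torus-ℓ¹ mass is `≤ 64·C₁L²·d(4L+1)^d·((L∕L^d)·L)^j·l2sq(tX̃)` (✓ `NE7QbarIterL1DbarFree.dirL1_QbarIter_sub_le`, row NE3's quadratic ℓ¹ tower without the B8
surface); ✓ H13 `seminorm_fderiv_fderiv_le_of_sq_bound` extracts the second derivative.  At `d = 4`, `((L∕L^d)·L)^j = L²·(L⁻¹)^{2(j+1)}`: j-UNIFORM — the successor multiplies by the
density `2·curl1C·ε` and feeds H11.
WHAT ([folklore]; 0 def, 0 sorry): §1 the torus-ℓ¹ functional on `skewSub` (**`dirL1_extDir_add_le`**, **`dirL1_extDir_smul`**, **`dirL1_extDir_le_norm`**, **`dirL1_extDir_skewPR_le`**),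
**`eventually_nhdsGT_mul_le`**; §2 **`dirL1_fderiv_fderiv_strippedConstraint_le`** (general `d`; hypotheses: the background letters of H7∕H8 with `2α₀`, and the two displayed k-free
lines `hS1` (radius sum) of row NE3's ℓ¹ tower — the `b`-lines of that tower are discharged here by `t → 0`).
HONEST FRAMING (page 1): lattice kinematics∕calculus on OUR objects from printed-type one-step letters; nothing of Bałaban's asserted; NOT (G′) (successor: × density, into H11),
NOT NE7 as a spine node; spine 0∕9; finite T⁴ rung (B)+1 — NOT infinite volume, NOT mass gap, NOT BetaPertH, NOT Clay.
-/

set_option autoImplicit false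

open scoped BigOperators Matrix Matrix.Norms.L2Operator Topology
open Filter Finset

namespace Summit.QuantumFields.BalabanUV.T4Continuum.NE7StrippedMultiplierLetterL1

open Literature.MathematicalPhysics.QuantumFieldTheory.Balaban1983to89
open B7Prop1Explicit B7Prop2Explicit B7Prop3Flat MatrixLog
open B7Prop4GeneralLevels (logCovIter)
open T4AveragingDeficitWall (Ad IsUnitaryCfg SmallField dirL1 dirSq)
open T4AveragingDeficitWallBoundary (IsPeriodicCfg periodBox)
open AveragingDeficitPeriodicCounting (IsPeriodicDir)
open AveragingDeficitTorusChart (TDir chartDir redN extDir resDir skewP chartDir_smul isPeriodicDir_chartDir redN_boxVec)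
open AveragingDeficitTwoLevelPrep (skewSub skewPR skewPF skewPF_apply)
open AveragingDeficitMultiLevelPrep (tower cavgIter LevelSmall tower_ne_zero)
open AveragingDeficitMultiLevelBridge (cavgIter_eq_avgIter)
open NE3TangentCovariantTower (QbarIter)
open NE3SmoothRightInverseW (QbarIter_smul)
open NE3CovariantLineSumsL2 (l2sq)
open NE3FramePotBoundW (tower_eq_pow_mul)
open NE3.QbarDictionary (adField)
open ReplicationRightInverseBound (radSum)
open BlockAverageVaryHolo (nbRad)
open NE3CovariantLineSumsError (Csup)
open ShellMeasureAverageProp4General (C1cov C1cov_pos)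
open NE7StrippedConstraintMap (strippedConstraint strippedConstraint_zero)
open NE7StrippedConstraintLinearisation (norm_chartDir_le qbarIterCLM_apply hasFDerivAt_strippedConstraint)
open NE7StrippedConstraintC2 (strippedConstraint_eq_skewPR_levelField contDiffAt_strippedConstraint)
open NE7QbarIterL1DbarFree (dirL1_QbarIter_sub_le)
open NE7SecondDerivativeFromQuadraticBound (seminorm_fderiv_fderiv_le_of_sq_bound)
open NE7MultiplierTermStepSharp (dirL1_extDir_eq_sum)
open NE7TorusChartDecoding (norm_skewP_le)

noncomputable section

variable {d : ℕ} {n : Type} [Fintype n] [DecidableEq n]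

/-! ## §1 The torus-ℓ¹ functional on the skew directions -/

/-- The torus-ℓ¹ mass `v ↦ dirL1 (extDir N v) (periodBox N) = Σ_{r,κ} ‖v r κ‖` is subadditive. [folklore] -/
theorem dirL1_extDir_add_le {N : ℕ} [NeZero N] (v w : ↥(skewSub d n N)) :
    dirL1 (extDir N ((v + w : ↥(skewSub d n N)) : TDir d n N)) (periodBox (d := d) N)
      ≤ dirL1 (extDir N (v : TDir d n N)) (periodBox (d := d) N) + dirL1 (extDir N (w : TDir d n N)) (periodBox (d := d) N) := by
  rw [dirL1_extDir_eq_sum, dirL1_extDir_eq_sum, dirL1_extDir_eq_sum, ← Finset.sum_add_distrib]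
  refine Finset.sum_le_sum fun r _ => ?_
  rw [← Finset.sum_add_distrib]
  exact Finset.sum_le_sum fun κ _ => norm_add_le _ _

/-- … absolutely homogeneous. [folklore] -/
theorem dirL1_extDir_smul {N : ℕ} [NeZero N] (c : ℝ) (v : ↥(skewSub d n N)) :
    dirL1 (extDir N ((c • v : ↥(skewSub d n N)) : TDir d n N)) (periodBox (d := d) N) = |c| * dirL1 (extDir N (v : TDir d n N)) (periodBox (d := d) N) := by
  rw [dirL1_extDir_eq_sum, dirL1_extDir_eq_sum, Finset.mul_sum]
  refine Finset.sum_congr rfl fun r _ => ?_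
  rw [Finset.mul_sum]
  refine Finset.sum_congr rfl fun κ _ => ?_
  rw [Submodule.coe_smul, Pi.smul_apply, Pi.smul_apply, norm_smul, Real.norm_eq_abs]

/-- … and dominated by the (sup) norm: `Σ_{r,κ} ‖v r κ‖ ≤ (#(Fin d → Fin N)·d)·‖v‖`. [folklore] -/
theorem dirL1_extDir_le_norm {N : ℕ} [NeZero N] (v : ↥(skewSub d n N)) :
    dirL1 (extDir N (v : TDir d n N)) (periodBox (d := d) N) ≤ (Fintype.card (Fin d → Fin N) * d : ℝ) * ‖v‖ := by
  rw [dirL1_extDir_eq_sum]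
  have h : ∀ (r : Fin d → Fin N) (κ : Fin d), ‖(v : TDir d n N) r κ‖ ≤ ‖v‖ := fun r κ =>
    (norm_le_pi_norm ((v : TDir d n N) r) κ).trans ((norm_le_pi_norm (v : TDir d n N) r).trans (le_of_eq rfl))
  calc ∑ r : Fin d → Fin N, ∑ κ : Fin d, ‖(v : TDir d n N) r κ‖
      ≤ ∑ r : Fin d → Fin N, ∑ κ : Fin d, ‖v‖ := Finset.sum_le_sum fun r _ => Finset.sum_le_sum fun κ _ => h r κ
    _ = (Fintype.card (Fin d → Fin N) * d : ℝ) * ‖v‖ := by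
        rw [Finset.sum_const, Finset.sum_const, Finset.card_univ, Finset.card_univ, Fintype.card_fin, nsmul_eq_mul, nsmul_eq_mul]; ring

/-- The torus-ℓ¹ mass of a skew projection is at most `Σ_{r,κ} ‖G r κ‖` (`‖skewP Y‖ ≤ ‖Y‖`). [folklore] -/
theorem dirL1_extDir_skewPR_le {N : ℕ} [NeZero N] (G : TDir d n N) :
    dirL1 (extDir N ((skewPR N G : ↥(skewSub d n N)) : TDir d n N)) (periodBox (d := d) N) ≤ ∑ r : Fin d → Fin N, ∑ κ : Fin d, ‖G r κ‖ := by
  rw [dirL1_extDir_eq_sum]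
  refine Finset.sum_le_sum fun r _ => Finset.sum_le_sum fun κ _ => ?_
  have e : ((skewPR N G : ↥(skewSub d n N)) : TDir d n N) r κ = skewP (G r κ) := by
    show (skewPF N G) r κ = skewP (G r κ)
    exact skewPF_apply N G r κ
  rw [e]
  exact norm_skewP_le _

/-- For `A ≥ 0` and `c > 0`, `t·A ≤ c` for all small `t > 0`. [folklore] -/
theorem eventually_nhdsGT_mul_le {A c : ℝ} (hA : 0 ≤ A) (hc : 0 < c) : ∀ᶠ t in 𝓝[>] (0 : ℝ), t * A ≤ c := by
  have h : ∀ᶠ t in 𝓝 (0 : ℝ), t < c / (A + 1) := eventually_lt_nhds (by positivity)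
  filter_upwards [nhdsWithin_le_nhds h, self_mem_nhdsWithin] with t ht ht0
  have ht0' : 0 < t := ht0
  have h1 : t * A ≤ t * (A + 1) := by nlinarith
  have h2 : t * (A + 1) < c := by rwa [lt_div_iff₀ (by positivity)] at ht
  linarith

/-- `dirL1` of a field over the period box is the sum over the box coordinates. [folklore] -/
theorem dirL1_periodBox_eq_sum {N : ℕ} [NeZero N] (F : Site d → Fin d → Matrix n n ℂ) :
    dirL1 F (periodBox (d := d) N) = ∑ r : Fin d → Fin N, ∑ κ : Fin d, ‖F (boxVec N r) κ‖ := by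
  unfold dirL1
  rw [periodBox, Finset.sum_image fun r _ r' _ h => T4TermwiseTorus.boxVec_injective N h]

/-- `l2sq` of a real multiple. [folklore] -/
theorem l2sq_smul_real (F : Finset (Site d)) (t : ℝ) (Z : Site d → Fin d → Matrix n n ℂ) : l2sq F (t • Z) = t ^ 2 * l2sq F Z := by
  unfold l2sq
  rw [Finset.mul_sum]
  refine Finset.sum_congr rfl fun z _ => ?_
  rw [Finset.mul_sum]
  refine Finset.sum_congr rfl fun κ _ => ?_
  rw [Pi.smul_apply, Pi.smul_apply, norm_smul, Real.norm_eq_abs, mul_pow, sq_abs]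

/-! ## §2 The scaled torus-ℓ¹ mass of `D²Ψ(0)[X,X]` -/

set_option maxHeartbeats 800000 in
/-- **THE SECOND DIFFERENTIAL OF THE STRIPPED CONSTRAINT HAS SCALED TORUS-ℓ¹ MASS** (see the module docstring):
`dirL1 (extDir N (D²Ψ(0)[X,X])) (periodBox N) ≤ 2·(64·C₁L²·d(4L+1)^d·((L∕L^d)·L)^j)·dirSq X̃ (periodBox (tower L N (j+1)))`, `X̃ = chartDir id X`. [folklore] -/
theorem dirL1_fderiv_fderiv_strippedConstraint_le [Nonempty n] {L N : ℕ} [NeZero L] [NeZero N] (hL : 2 ≤ L) (hN : 1 ≤ N) (j : ℕ)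
    {Us : Site d → Fin d → (Matrix n n ℂ)ˣ} {x : ℝ} (hUu : IsUnitaryCfg Us) (hUP : IsPeriodicCfg Us ((N * L ^ (j + 1) : ℕ) : ℤ))
    (hx : 0 ≤ x) (hs : LevelSmall d L j x) (hUx : SmallField Us x)
    {α₀ : ℝ} (hα : 0 < α₀) (hα3 : C0 d * (2 * α₀) ≤ 1 / 3) (hα4 : 4 * (2 * α₀) ≤ c2' d L) (h52 : pdev Us < α₀ * (((L : ℝ) ^ (j + 1))⁻¹) ^ 2)
    (hroom : Real.exp (4 * (800 * ((d : ℝ) + 1) ^ 2 * ((d : ℝ) + 4)) * α₀) ≤ 3 / 2)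
    (hS1 : (16 * (d + 1) * (d + 4) * (L : ℝ) ^ 2 * Csup d L * (d * (2 * nbRad d L + 1) ^ d)) * radSum d L j x ≤ ((L : ℝ) / (L : ℝ) ^ d) / 2)
    (X : ↥(skewSub d n (L * tower L N j))) :
    dirL1 (extDir N ((fderiv ℝ (fderiv ℝ (strippedConstraint L N j Us)) 0 X X : ↥(skewSub d n N)) : TDir d n N)) (periodBox (d := d) N)
      ≤ 2 * ((64 * (C1cov d * (L : ℝ) ^ 2 * (d * (2 * (2 * (L : ℝ)) + 1) ^ d)) * (((L : ℝ) / (L : ℝ) ^ d) * L) ^ (j + 1 - 1))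
          * dirSq (chartDir (ContinuousLinearMap.id ℝ (Matrix n n ℂ)) (L * tower L N j) (X : TDir d n (L * tower L N j))) (periodBox (d := d) (tower L N (j + 1)))) := by
  haveI : NeZero (L * tower L N j) := ⟨Nat.mul_ne_zero (NeZero.ne L) (tower_ne_zero L N j)⟩
  have hL1 : 1 ≤ L := le_trans (by norm_num) hL
  have hL0 : (0 : ℝ) < L := by exact_mod_cast (show 0 < L by omega)
  have hLp : 0 < (L : ℝ) ^ (j + 1) := by positivity
  -- the weaker `α₀`-lines of H7∕H8
  have hC0 : 0 ≤ C0 d := by unfold C0; positivity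
  have hα3' : C0 d * α₀ ≤ 1 / 3 := by nlinarith
  have hα4' : 4 * α₀ ≤ c2' d L := by linarith
  -- `Ψ` is `C²` at `0`, `Ψ 0 = 0`, `DΨ(0) = qbarIterCLM`
  have hΨ2 : ContDiffAt ℝ 2 (strippedConstraint L N j Us) 0 := contDiffAt_strippedConstraint (N := N) hL j hUu hα hα3' hα4' h52 hroom
  have hΨ0 : strippedConstraint L N j Us 0 = 0 := strippedConstraint_zero L N j Us
  have hD := (hasFDerivAt_strippedConstraint (N := N) hL j hUu hx hs hUx hα hα3' hα4' h52 hroom).fderiv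
  -- the fine field `X̃`, its sup and its period
  have eM : N * L ^ (j + 1) = L * tower L N j := by rw [tower_eq_pow_mul]; ring
  have hXb : ∀ (y : Site d) (κ : Fin d), ‖chartDir (ContinuousLinearMap.id ℝ (Matrix n n ℂ)) (L * tower L N j) (X : TDir d n (L * tower L N j)) y κ‖ ≤ ‖X‖ :=
    fun y κ => norm_chartDir_le (X : TDir d n (L * tower L N j)) y κ
  have hXP : IsPeriodicDir (chartDir (ContinuousLinearMap.id ℝ (Matrix n n ℂ)) (L * tower L N j) (X : TDir d n (L * tower L N j))) ((N * L ^ (j + 1) : ℕ) : ℤ) := by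
    rw [eM]; exact isPeriodicDir_chartDir _ _ _
  -- positive constants
  have hc3 : 0 < c3 d L := by unfold c3; positivity
  have hlog2 : 0 < Real.log 2 := Real.log_pos (by norm_num)
  have hsq : 0 < Real.sqrt ((L : ℝ) ^ 2 / (L : ℝ) ^ d) := Real.sqrt_pos.mpr (by positivity)
  have hC1 := C1cov_pos d
  -- the four smallness lines in `b = t‖X‖`, for small `t > 0`
  have e1 := eventually_nhdsGT_mul_le (A := 8 * (131072 * ((d : ℝ) + 1) ^ 2) * ((L : ℝ) ^ (j + 1) * ‖X‖)) (c := 1 / 3) (by positivity) (by norm_num)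
  have e2 := eventually_nhdsGT_mul_le (A := 4 * ((L : ℝ) ^ (j + 1) * ‖X‖)) (c := c3 d L) (by positivity) hc3
  have e3 := eventually_nhdsGT_mul_le (A := 2 * ((L : ℝ) ^ (j + 1) * ‖X‖)) (c := Real.log 2 / 2) (by positivity) (by positivity)
  have e4 := eventually_nhdsGT_mul_le (A := 16 * (C1cov d * (L : ℝ) ^ 2 * Real.sqrt (d * (2 * (2 * L) + 1) ^ d)) * (L : ℝ) ^ (j + 1) * ‖X‖)
    (c := Real.sqrt ((L : ℝ) ^ 2 / (L : ℝ) ^ d)) (by positivity) hsq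
  have e0 : ∀ᶠ t in 𝓝[>] (0 : ℝ), 0 < t := eventually_mem_nhdsWithin
  -- the quadratic bound of `Ψ(tX) − t·DΨ(0)X` in the torus-ℓ¹ mass
  have hK : ∀ᶠ t in 𝓝[>] (0 : ℝ),
      dirL1 (extDir N ((strippedConstraint L N j Us (t • X) - t • fderiv ℝ (strippedConstraint L N j Us) 0 X : ↥(skewSub d n N)) : TDir d n N)) (periodBox (d := d) N)
        ≤ ((64 * (C1cov d * (L : ℝ) ^ 2 * (d * (2 * (2 * (L : ℝ)) + 1) ^ d)) * (((L : ℝ) / (L : ℝ) ^ d) * L) ^ (j + 1 - 1))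
            * l2sq (periodBox (d := d) (N * L ^ (j + 1))) (chartDir (ContinuousLinearMap.id ℝ (Matrix n n ℂ)) (L * tower L N j) (X : TDir d n (L * tower L N j)))) * t ^ 2 := by
    filter_upwards [e0, e1, e2, e3, e4] with t ht0 h1 h2 h3 h4
    have hb : 0 ≤ t * ‖X‖ := by positivity
    have htX : ‖t • X‖ ≤ t * ‖X‖ := by rw [norm_smul, Real.norm_eq_abs, abs_of_pos ht0]
    -- the `b`-lines
    have hsmall : Real.exp (4 * (800 * ((d : ℝ) + 1) ^ 2 * ((d : ℝ) + 4)) * α₀) * (1 + 8 * (131072 * ((d : ℝ) + 1) ^ 2) * ((L : ℝ) ^ (j + 1) * (t * ‖X‖))) ≤ 2 := by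
      have h1' : 8 * (131072 * ((d : ℝ) + 1) ^ 2) * ((L : ℝ) ^ (j + 1) * (t * ‖X‖)) ≤ 1 / 3 := by
        calc 8 * (131072 * ((d : ℝ) + 1) ^ 2) * ((L : ℝ) ^ (j + 1) * (t * ‖X‖)) = t * (8 * (131072 * ((d : ℝ) + 1) ^ 2) * ((L : ℝ) ^ (j + 1) * ‖X‖)) := by ring
          _ ≤ 1 / 3 := h1
      have h0 : 0 ≤ 8 * (131072 * ((d : ℝ) + 1) ^ 2) * ((L : ℝ) ^ (j + 1) * (t * ‖X‖)) := by positivity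
      have hexp0 : 0 ≤ Real.exp (4 * (800 * ((d : ℝ) + 1) ^ 2 * ((d : ℝ) + 4)) * α₀) := (Real.exp_pos _).le
      nlinarith
    have hc₃4 : 4 * ((L : ℝ) ^ (j + 1) * (t * ‖X‖)) ≤ c3 d L := by
      calc 4 * ((L : ℝ) ^ (j + 1) * (t * ‖X‖)) = t * (4 * ((L : ℝ) ^ (j + 1) * ‖X‖)) := by ring
        _ ≤ c3 d L := h2
    have hc₃2 : 2 * ((L : ℝ) ^ (j + 1) * (t * ‖X‖)) ≤ c3 d L := by nlinarith [pow_pos hL0 (j + 1), norm_nonneg X]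
    have hlog : 2 * ((L : ℝ) ^ (j + 1) * (t * ‖X‖)) < Real.log 2 := by
      calc 2 * ((L : ℝ) ^ (j + 1) * (t * ‖X‖)) = t * (2 * ((L : ℝ) ^ (j + 1) * ‖X‖)) := by ring
        _ ≤ Real.log 2 / 2 := h3
        _ < Real.log 2 := by linarith
    have hKb : 16 * (C1cov d * (L : ℝ) ^ 2 * Real.sqrt (d * (2 * (2 * L) + 1) ^ d)) * (L : ℝ) ^ (j + 1) * (t * ‖X‖) ≤ Real.sqrt ((L : ℝ) ^ 2 / (L : ℝ) ^ d) := by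
      calc 16 * (C1cov d * (L : ℝ) ^ 2 * Real.sqrt (d * (2 * (2 * L) + 1) ^ d)) * (L : ℝ) ^ (j + 1) * (t * ‖X‖)
          = t * (16 * (C1cov d * (L : ℝ) ^ 2 * Real.sqrt (d * (2 * (2 * L) + 1) ^ d)) * (L : ℝ) ^ (j + 1) * ‖X‖) := by ring
        _ ≤ Real.sqrt ((L : ℝ) ^ 2 / (L : ℝ) ^ d) := h4
    -- the scaled field `tX̃`
    have hct : chartDir (ContinuousLinearMap.id ℝ (Matrix n n ℂ)) (L * tower L N j) ((t • X : ↥(skewSub d n (L * tower L N j))) : TDir d n (L * tower L N j))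
        = t • chartDir (ContinuousLinearMap.id ℝ (Matrix n n ℂ)) (L * tower L N j) (X : TDir d n (L * tower L N j)) := by
      funext y μ
      rw [Submodule.coe_smul, chartDir_smul, Complex.coe_smul, Pi.smul_apply, Pi.smul_apply]
    have hZb : ∀ (y : Site d) (κ : Fin d), ‖(t • chartDir (ContinuousLinearMap.id ℝ (Matrix n n ℂ)) (L * tower L N j) (X : TDir d n (L * tower L N j))) y κ‖ ≤ t * ‖X‖ := by
      intro y κ
      rw [Pi.smul_apply, Pi.smul_apply, norm_smul, Real.norm_eq_abs, abs_of_pos ht0]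
      exact mul_le_mul_of_nonneg_left (hXb y κ) ht0.le
    have hZP : IsPeriodicDir (t • chartDir (ContinuousLinearMap.id ℝ (Matrix n n ℂ)) (L * tower L N j) (X : TDir d n (L * tower L N j))) ((N * L ^ (j + 1) : ℕ) : ℤ) := by
      intro y i μ
      rw [Pi.smul_apply, Pi.smul_apply, Pi.smul_apply, Pi.smul_apply, hXP y i μ]
    -- `Ψ(tX)` in the regime and `t·DΨ(0)X`
    have hΨt := strippedConstraint_eq_skewPR_levelField (N := N) hL j hUu hα hα3' hα4' h52 (t • X) htX hsmall hc₃2 hlog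
    rw [hct] at hΨt
    have hDX : t • fderiv ℝ (strippedConstraint L N j Us) 0 X
        = skewPR N (resDir N (QbarIter L (j + 1) Us (t • chartDir (ContinuousLinearMap.id ℝ (Matrix n n ℂ)) (L * tower L N j) (X : TDir d n (L * tower L N j))))) := by
      rw [hD, qbarIterCLM_apply, QbarIter_smul hL1 j hUu hx hs hUx t, ← map_smul]
      rfl
    -- gen 96's end-framed remainder bound for `Z = tX̃`, `b = t‖X‖`
    have hrem := dirL1_QbarIter_sub_le hL hN j hUu hUP hx hs hUx hα hα3 hα4 h52 hb hZb hZP hsmall hc₃4 hKb hS1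
    rw [cavgIter_eq_avgIter, l2sq_smul_real] at hrem
    -- the difference is the skew projection of (minus) that remainder, read on the box coordinates
    rw [hΨt, hDX, ← map_sub]
    refine (dirL1_extDir_skewPR_le _).trans ?_
    rw [dirL1_periodBox_eq_sum] at hrem
    refine le_trans (le_of_eq ?_) (hrem.trans (le_of_eq (by ring)))
    refine Finset.sum_congr rfl fun r _ => Finset.sum_congr rfl fun κ _ => ?_
    rw [Pi.sub_apply, Pi.sub_apply, ← norm_neg, neg_sub]
    rfl
  -- extraction of the second derivative
  have main := seminorm_fderiv_fderiv_le_of_sq_bound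
    (fun v : ↥(skewSub d n N) => dirL1 (extDir N (v : TDir d n N)) (periodBox (d := d) N))
    (Cp := (Fintype.card (Fin d → Fin N) * d : ℝ)) dirL1_extDir_add_le dirL1_extDir_smul dirL1_extDir_le_norm hΨ2 hΨ0 X hK
  refine main.trans (le_of_eq ?_)
  rw [eM]
  rfl

end

end Summit.QuantumFields.BalabanUV.T4Continuum.NE7StrippedMultiplierLetterL1
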